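import Mathlib
import Literature.MathematicalPhysics.QuantumFieldTheory.Balaban1983to89.B16
import Literature.MathematicalPhysics.QuantumFieldTheory.Balaban1983to89.Step

/-!
# `Balaban1983to89.B14Cor3` — [Balaban1988Convergent] Corollary 3 (2.50) p. 264: the printed derivation paragraph
KERNEL-CHECKED as "(2.50) ⇐ five named leaves" over the representation (2.18)

CITATION HEADER (lean-in-tree rule 2026-08-18).  Source: T. Bałaban, *Convergent renormalization expansions for lattice
gauge theories*, Commun. Math. Phys. **119**, 243–285 (1988), doi:10.1007/bf01217741 (cell paper B14 = [III] of the
large-field series; held: `paper:balaban1988-cmp119-convergent-renormalization`; journal page = PDF page + 242;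
quotations below are read from the page renders pp. 257, 262–264), together with the one sentence of
[Balaban1989LargeFieldII] (B16) p. 387 that closes the printed proof.  WHAT IS REPRODUCED (statement level, surge node
T11.4 "sharpen"; the sibling modules `B14`, `B16`, `Step` are NOT modified):

(a) THE PRINTED TEXT.  p. 264 [PDF 22], after (2.49) `A_k(1/g_k², U_k) = −A(1/g_k², U_k) + (the logarithmic terms) +
O(1) Σ_{j=1}^{k} |Γ_j|`: *"The first term on the right-hand side yields the small factors for large field characteristic
functions. It also controls the logarithmic terms. Thus we estimate the integral ∫dV_k ρ_k by a sum of terms similar to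
the one considered in Sect. 3 [6], e.g., see (3.42). The procedure is constructed in such a way, that the combinatorics
now is the same, relative to the η-scale of the lattice T_η, as in [6], hence we have the same result for this scale.
Corollary 3. (Ultraviolet Stability). Under the assumptions of Theorem 1 there exist constants E₋, E₊ independent of η
and T, but depending on g_k, such that χ_k(T_η) exp[−(1/g_k²) A(U_k(V_k)) − E₋|T_η|] ≤ ρ_k(V_k) ≤ e^{E₊|T_η|}. (2.50)"*.
Here [6] = entry 6 of the reference list of [I] ([Balaban1987RG1] p. 301) = [Balaban1982Higgs2] (cell paper B2), whose
§3.C pp. 592–594 is headed *"C. The Combinatorial Estimate. In this section we will prove the inequality (3.42). The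
proof is purely combinatoric and model-independent"* (cell GAPS.md G-adv3-1 (1) and DIVERGENCE D-adv3-1: the render
reads "[6]", not "[16]"; the verbatim (3.42) is typed in the sibling module `B2` by unit pv04, claim P00-B2-342).  B16
p. 387 [PDF 33]: *"hence also an improved bound (1.89), with the additional term −κ₁d_k(X) in the exponential. This
implies the inequality (2.50) [III], hence Corollary 3."*

(b) THE TYPED READING.  The density is the finite sum (2.18) p. 257 `ρ_k(V_k) = Σ_{{Ω_j},{Λ_j}} χ_k(Ω_k)
𝐓_k({Ω_j},{Λ_j}) exp A_k(1/g_k², U_k)` over admissible sequences of domains (`TermData`: the finite index type, the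
summands as functions of `V_k`, the numerical "(3.42)-type term" the text assigns to each summand as its majorant, and
the all-small-field sequence `Ω_j = Λ_j =` the whole lattice).  The paragraph then IS the following bookkeeping, and
nothing more is asserted here: the UPPER half of (2.50) ⇐ (H) the representation (2.18) holds ∧ (U1) every summand is
bounded by its majorant (*"the first term … yields the small factors for large field characteristic functions. It also
controls the logarithmic terms"*; B16 (1.89), `Step.FundIneq189`) ∧ (U2) the sum of the majorants over admissible
sequences is `≤ exp(E₊|T_η|)` (*"the combinatorics now is the same, relative to the η-scale …, as in [6], hence we have
the same result for this scale"* = B2 (3.42) TRANSFERRED to the three-sequence structure `{Ω_j},{Λ_j},{S_j}` of §2 — a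
transfer not carried out in print: cell GAPS.md G-adv3-1 (2)(i) dictionary, (ii) collected exponent inequality, (iii)
the 𝐑-operation's ratio factors); the LOWER half of (2.50) ⇐ (H) ∧ (L1) every summand is non-negative for real fields ∧
(L2) the all-small-field summand alone is `≥ χ_k(T_η) exp[−(1/g_k²)A(U_k(V_k)) − E₋|T_η|]` ((2.49) with no large-field
regions, the logarithmic terms bounded by `O(log g_k⁻²)` per unit volume) — NEITHER (L1) NOR (L2) IS PRINTED in d = 4
(cell GAPS.md G-adv3-2; contrast [Balaban1985UV3] (37)/(47) in d = 3, where the lower bound is its own inductive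
inequality, and [Balaban1982Higgs1] for Higgs₂,₃).  Kernel-checked: `le_of_sum_repr` / `ge_of_sum_repr` (the two
finite-sum facts), `uvIneq_of_termData` (one run, one step: H ∧ U1 ∧ U2 ∧ L1 ∧ L2 ⇒ `B16.UVIneq`),
`cor3With_of_leaves`, `cor3_250_of_leaves`, `cor3Leaf_of_leaves : … → B16.Cor3Leaf C` (the sibling module's opaque
leaf "Theorem 1 ⇒ Corollary 3" becomes "Theorem 1 ∧ H ∧ U1 ∧ U2 ∧ L1 ∧ L2 ⇒ Corollary 3", the two γ's merged by
`min`), `uvBound01_of_leaves` / `endStatementB_of_leaves` (into `B16.UVBound01` / `B16.EndStatementB` when the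
dependence functions `e_±(g_k)` are bounded on ]0, γ], via `B16.uvBound01_of_cor3_bounded`), and, at the level of
densities on gauge fields (`Step.Repr218`, `Step.DensityRG`): `density_le_of_repr218`, `density_ge_of_repr218`,
`partitionFn_le_of_repr218` (the sentence *"we estimate the integral ∫dV_kρ_k"*: pointwise majorants + the integral
invariant `Step.DensityRG.partitionFn_le_exp`), and the integrated form `integral_le_of_termwise` (term-wise INTEGRAL
bounds, with the integrability binder the Bochner integral needs).

WHAT IS *NOT* REPRODUCED OR ASSERTED: (2.18), (2.49), B16 (1.89) and B2 (3.42) themselves — they enter only as the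
hypotheses H/U1/U2/L1/L2; the DICTIONARY B2 ↦ B14 (sequences `Λ^{(k)}` ↦ `{Ω_j},{Λ_j},{S_j}`; B2's per-cube small
factor `exp(−½γ₀p(L^kε)²)` ↦ (1.89) and (2.4)–(2.5); B2's proviso p. 594 *"if 2p ≥ (d+1)r and ε₀ is sufficiently
small"* ↦ the local exponent conditions of B16 pp. 383–387) and the collected exponent inequality that would make U2 a
theorem (G-adv3-1 (2)(ii); cell SMALLNESS.md / GAPS C-r2.10); the sentence *"we estimate the integral"* versus the
POINTWISE statement (2.50) (the pointwise upper bound follows from the same majorants since (1.89) is pointwise in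
`V_k`; G-adv3-1 scope note — both readings are typed).  The representation family `R` is DATA supplied by the reader of
§2; instantiated with the one-term representation (`Adm = Unit`, summand `ρ_k`, majorant `exp(E₊|T_η|)`) the leaves
merely restate (2.50) — the content of this module is the printed STRUCTURE of the derivation with each leaf located,
not an estimate.  NOTHING of the series is asserted; value = typed skeleton + located gaps, NOT summit progress.  Unit
`b2b-balaban-pv06` (surge node prover #06); companion rows: cell `GAPS.md` G-adv3-1, G-adv3-2 (the located inputs),
C-pv06-1 (this certification), `DIVERGENCE.md` D-pv06.1.
-/

namespace Literature.MathematicalPhysics.QuantumFieldTheory.Balaban1983to89.B14Cor3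

open _root_.MeasureTheory
open Literature.MathematicalPhysics.QuantumFieldTheory.Balaban1983to89

/-! ## 1. The two finite-sum facts the paragraph uses -/

/-- Upper half of the bookkeeping: a quantity represented as a finite sum, `x = Σ_a t(a)`, each summand bounded by a
numerical majorant, `t(a) ≤ w(a)`, and the majorants summable to `≤ B`, is `≤ B`. [folklore] -/
theorem le_of_sum_repr {A : Type*} [Fintype A] {x B : ℝ} (t w : A → ℝ)
    (hrepr : x = ∑ a, t a) (hterm : ∀ a, t a ≤ w a) (hsum : ∑ a, w a ≤ B) : x ≤ B := by
  rw [hrepr]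
  exact (Finset.sum_le_sum fun a _ => hterm a).trans hsum

/-- Lower half of the bookkeeping: a quantity represented as a finite sum of NON-NEGATIVE summands is bounded below by
any one summand, hence by any lower bound of a chosen summand `a₀`. [folklore] -/
theorem ge_of_sum_repr {A : Type*} [Fintype A] {x l : ℝ} (t : A → ℝ) (a₀ : A)
    (hrepr : x = ∑ a, t a) (hnonneg : ∀ a, 0 ≤ t a) (hlow : l ≤ t a₀) : l ≤ x := by
  rw [hrepr]
  exact hlow.trans (Finset.single_le_sum (fun a _ => hnonneg a) (Finset.mem_univ a₀))

/-- The integrated reading of p. 264 *"we estimate the integral ∫dV_k ρ_k by a sum of terms"*: if `ρ = Σ_a t(a, ·)`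
with every summand integrable, each `∫ t(a, ·) ≤ w(a)` and `Σ_a w(a) ≤ B`, then `∫ ρ ≤ B`.  The integrability binder
is necessary for the exchange `∫ Σ = Σ ∫` of the Bochner integral (`MeasureTheory.integral_finsetSum`). [folklore] -/
theorem integral_le_of_termwise {A Ω : Type*} [Fintype A] [MeasurableSpace Ω] (μ : Measure Ω)
    (ρ : Ω → ℝ) (t : A → Ω → ℝ) (w : A → ℝ) (B : ℝ)
    (hrepr : ∀ v, ρ v = ∑ a, t a v) (hint : ∀ a, Integrable (t a) μ)
    (hterm : ∀ a, ∫ v, t a v ∂μ ≤ w a) (hsum : ∑ a, w a ≤ B) :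
    ∫ v, ρ v ∂μ ≤ B := by
  have h1 : (fun v => ρ v) = fun v => ∑ a, t a v := funext hrepr
  rw [h1, integral_finsetSum _ (fun a _ => hint a)]
  exact (Finset.sum_le_sum fun a _ => hterm a).trans hsum

/-! ## 2. The representation (2.18) at the level of the sibling module `B16` (one run, one step) -/

/-- The DATA of the representation (2.18) p. 257 [15] of the k-th density of ONE run, at the abstraction level of the
sibling module `B16` (configurations `D.Cfg k`, density `D.ρ k`), verbatim: *"The density ρ_k(V_k) can be represented
as ρ_k(V_k) = Σ_{{Ω_j},{Λ_j}} χ_k(Ω_k) 𝐓_k({Ω_j},{Λ_j}) exp A_k(1/g_k², U_k), (2.18) where the summation is over the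
admissible sequences of domains. Summation over the sequences {S_j} is included in the operation 𝐓_k."*  Fields:
`Adm` = the finite set of admissible sequences `({Ω_j},{Λ_j})` ((2.1)–(2.3) p. 255; finite because `T_η` is); `term a`
= the summand `χ_k(Ω_k) 𝐓_k({Ω_j},{Λ_j}) exp A_k(1/g_k², U_k)` as a function of `V_k`; `major a` = the numerical
"term similar to the one considered in Sect. 3 [6], e.g., see (3.42)" (p. 264) that the text assigns to the summand as
its majorant; `allSmall` = the sequence with no large fields, `Ω_j = Λ_j =` the whole lattice for all `j` (so that
`Γ_j = ∅` for `j < k`, `Γ_k = T₁^{(k)}` by (2.2), no operation 𝐓 acts and the 𝐑-ratio is 1).  The gauge-field level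
version of the same data is `Step.Repr218`. [cite: Balaban1988Convergent, (2.18) p.257] -/
structure TermData (D : B16.RunData) (k : ℕ) where
  Adm : Type
  [finAdm : Fintype Adm]
  term : Adm → D.Cfg k → ℝ
  major : Adm → ℝ
  allSmall : Adm

/-- The index type of admissible sequences of a `TermData` is finite (field `finAdm`), registered so that the sum
(2.18) elaborates. [folklore] -/
instance TermData.instFintypeAdm {D : B16.RunData} {k : ℕ} (R : TermData D k) : Fintype R.Adm := R.finAdm

/-- (2.18) HOLDS for the data `R` at step `k` of the run `D`: `ρ_k(V_k) = Σ_a term(a)(V_k)` for every configuration.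
[cite: Balaban1988Convergent, (2.18) p.257] -/
def TermData.Holds {D : B16.RunData} {k : ℕ} (R : TermData D k) : Prop :=
  ∀ V : D.Cfg k, D.ρ k V = ∑ a : R.Adm, R.term a V

/-- ONE RUN, ONE STEP: the printed derivation of (2.50) as bookkeeping.  If (H) the representation (2.18) holds, (U1)
every summand is bounded by its majorant, (U2) the majorants sum to `≤ exp(E₊|T_η|)`, (L1) every summand is `≥ 0`, and
(L2) the all-small-field summand is `≥ χ_k exp[−(1/g_k²)A(U_k(V_k)) − E₋|T_η|]`, then the two-sided inequality
`B16.UVIneq` ((2.50) / (0.1) of [Balaban1989LargeFieldII]) holds at every configuration.  `le_of_sum_repr` +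
`ge_of_sum_repr`; no analytic content. [cite: Balaban1988Convergent, Cor. 3 (2.50) p.264] -/
theorem uvIneq_of_termData (D : B16.RunData) (k : ℕ) (R : TermData D k) (Em Ep : ℝ)
    (hH : R.Holds)
    (hU1 : ∀ a V, R.term a V ≤ R.major a)
    (hU2 : ∑ a, R.major a ≤ Real.exp (Ep * (D.numSites k : ℝ)))
    (hL1 : ∀ a V, 0 ≤ R.term a V)
    (hL2 : ∀ V, D.χ k V * Real.exp (-(1 / (D.flow.g k) ^ 2 * D.wilsonBG k V) - Em * (D.numSites k : ℝ))
      ≤ R.term R.allSmall V) :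
    ∀ V : D.Cfg k, B16.UVIneq D k V Em Ep := by
  intro V
  refine ⟨?_, ?_⟩
  · exact ge_of_sum_repr (fun a => R.term a V) R.allSmall (hH V) (fun a => hL1 a V) (hL2 V)
  · exact le_of_sum_repr (fun a => R.term a V) R.major (hH V) (fun a => hU1 a V) hU2

/-! ## 3. The five leaves over a whole construction, guarded as Corollary 3 is ("under the assumptions of Theorem 1") -/

/-- A representation family: the (2.18) data for every run `P` (lattice `T_η`, `η = L^{−K}`, torus `L^m`, bare
coupling) and every step `k` of a `B16.Construction`.  DATA supplied by the reader of §2 (the expansion (2.18) is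
produced by the inductive construction itself, Theorem 1 p. 262). [cite: Balaban1988Convergent, (2.18) p.257] -/
def ReprFamily (C : B16.Construction) : Type 1 :=
  ∀ P : B12.RunParams, ∀ k : ℕ, TermData (C P) k

/-- Leaf **(H)**: under the assumptions of Theorem 1 (couplings in ]0, γ], `Setup.Flow.InInterval`) and given its
conclusion at step `k` (`Sect2Form k`, the §2 inductive description), the representation (2.18) holds with the data
`R P k`.  Printed: (2.18) p. 257 is part of the inductive description that Theorem 1 p. 262 asserts for all `k`. [cite: Balaban1988Convergent, (2.18) p.257] -/
def LeafH (C : B16.Construction) (R : ReprFamily C) (γ : ℝ) : Prop :=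
  ∀ P : B12.RunParams, (C P).flow.InInterval γ P.K → ∀ k, k ≤ P.K → (C P).Sect2Form k → (R P k).Holds

/-- Leaf **(U1)** — the per-term bound, p. 264: *"The first term on the right-hand side [of (2.49), −A(1/g_k², U_k)]
yields the small factors for large field characteristic functions. It also controls the logarithmic terms."*, closed in
[Balaban1989LargeFieldII] p. 387 by *"the fundamental inequality 𝐓′_k(X)1 ≤ exp(−2(1+β₀)⁻¹p₀(g_k)) (1.89) … with the
additional term −κ₁d_k(X) in the exponential. This implies the inequality (2.50) [III]"* (`Step.FundIneq189`): every
summand of (2.18), as a function of `V_k`, is bounded by the numerical (3.42)-type term assigned to it.  ASSERTED BY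
SIMILARITY in print (no displayed inequality `term ≤ majorant` exists in [III]–[V]); typed as a hypothesis. [cite: Balaban1988Convergent, p.264 lines after (2.49)] -/
def LeafU1 (C : B16.Construction) (R : ReprFamily C) (γ : ℝ) : Prop :=
  ∀ P : B12.RunParams, (C P).flow.InInterval γ P.K → ∀ k, k ≤ P.K → (C P).Sect2Form k →
    ∀ a : (R P k).Adm, ∀ V : (C P).Cfg k, (R P k).term a V ≤ (R P k).major a

/-- Leaf **(U2)** — the TRANSFERRED combinatorial estimate, p. 264: *"Thus we estimate the integral ∫dV_k ρ_k by a sum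
of terms similar to the one considered in Sect. 3 [6], e.g., see (3.42). The procedure is constructed in such a way,
that the combinatorics now is the same, relative to the η-scale of the lattice T_η, as in [6], hence we have the same
result for this scale."*: the sum of the majorants over all admissible sequences is `≤ exp(E₊|T_η|)` with `E₊ = e₊(g_k)`
(*"depending on g_k"*, Cor. 3).  [6] = [Balaban1982Higgs2] §3.C, (3.42) p. 592, proved there for the minimal sequences
`Λ^{(0)}, …, Λ^{(K−1)}` of the Higgs₂,₃ model under the proviso p. 594 *"if 2p ≥ (d+1)r and ε₀ is sufficiently small"*
(verbatim in the sibling module `B2`); the transfer to the three-sequence structure of §2 with the 𝐑-operation and the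
exponents (2.4)–(2.7) is NOT carried out in print (cell GAPS.md G-adv3-1 (2)(i)–(iii)).  Typed as a hypothesis. [cite: Balaban1988Convergent, p.264 paragraph before Cor. 3] -/
def LeafU2 (C : B16.Construction) (R : ReprFamily C) (γ : ℝ) (ep : ℝ → ℝ) : Prop :=
  ∀ P : B12.RunParams, (C P).flow.InInterval γ P.K → ∀ k, k ≤ P.K → (C P).Sect2Form k →
    ∑ a : (R P k).Adm, (R P k).major a ≤ Real.exp (ep ((C P).flow.g k) * ((C P).numSites k : ℝ))

/-- Leaf **(L1)** — term-wise NON-NEGATIVITY of the representation (2.18) for real fields `V_k`: every summand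
`χ_k(Ω_k) 𝐓_k({Ω_j},{Λ_j}) exp A_k` is `≥ 0`.  UNPRINTED in d = 4 (cell GAPS.md G-adv3-2 (L1)): the only discharge in
print is [Balaban1989LargeFieldII] p. 380 *"The expression 𝐓′_k(X,(U,0))1 is obviously positive, although it may be
very small"* (positivity of one factor at `J = 0` and non-vanishing at `J ≠ 0`, (1.73)–(1.75)), while
[Balaban1989LargeFieldI] p. 176 promises *"We will prove that the densities are positive"*; reality/positivity of the
exponentiated polymer terms of (1.98)/(1.104) is not asserted.  Typed as a hypothesis. [cite: Balaban1989LargeFieldII, p.380 (1.73)–(1.75)] -/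
def LeafL1 (C : B16.Construction) (R : ReprFamily C) (γ : ℝ) : Prop :=
  ∀ P : B12.RunParams, (C P).flow.InInterval γ P.K → ∀ k, k ≤ P.K → (C P).Sect2Form k →
    ∀ a : (R P k).Adm, ∀ V : (C P).Cfg k, 0 ≤ (R P k).term a V

/-- Leaf **(L2)** — the LOWER bound of the all-small-field summand alone: for the sequence `Ω_j = Λ_j =` the whole
lattice (no operation 𝐓, 𝐑-ratio 1, `Σ_j|Γ_j| = |T₁^{(k)}|` by (2.2)), (2.49) p. 264 `A_k(1/g_k², U_k) = −A(1/g_k², U_k)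
+ (the logarithmic terms) + O(1)Σ_{j=1}^{k}|Γ_j|` with the logarithmic terms bounded by `O(log g_k⁻²)` per unit volume
gives `χ_k(T_η) exp[−(1/g_k²)A(U_k(V_k)) − E₋|T_η|] ≤ χ_k(T_η) exp A_k(1/g_k², U_k(V_k))`, `E₋ = e₋(g_k)`.  UNPRINTED
in d = 4 (cell GAPS.md G-adv3-2 (L2); in d = 3 the lower bound is the separate inductive inequality (37)/(47) of
[Balaban1985UV3], p. 272 *"The lower bound is proved in the same way, with all simplifications coming from the fact
that Ω_{k+1} = T_η"*).  Typed as a hypothesis, with `χ_k(T_η)` = the sibling module's `D.χ k` and `A(U_k(V_k))` =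
`D.wilsonBG k`, exactly as in `B16.UVIneq`. [cite: Balaban1988Convergent, (2.49)–(2.50) p.264] -/
def LeafL2 (C : B16.Construction) (R : ReprFamily C) (γ : ℝ) (em : ℝ → ℝ) : Prop :=
  ∀ P : B12.RunParams, (C P).flow.InInterval γ P.K → ∀ k, k ≤ P.K → (C P).Sect2Form k →
    ∀ V : (C P).Cfg k,
      (C P).χ k V * Real.exp (-(1 / ((C P).flow.g k) ^ 2 * (C P).wilsonBG k V)
          - em ((C P).flow.g k) * ((C P).numSites k : ℝ))
        ≤ (R P k).term (R P k).allSmall V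

/-! ## 4. Corollary 3 from the leaves -/

/-- The interval hypothesis is monotone in `γ`: couplings in ]0, γ] are in ]0, γ'] for `γ ≤ γ'`. [folklore] -/
theorem inInterval_of_le {F : Flow} {γ γ' : ℝ} {K : ℕ} (h : F.InInterval γ K) (hle : γ ≤ γ') :
    F.InInterval γ' K :=
  fun k hk => ⟨(h k hk).1, (h k hk).2.trans hle⟩

/-- (2.50) with the dependence functions `e_±`, on ]0, γ], from the five leaves on ]0, γ] AND the conclusion of
Theorem 1 on the same interval (`∀ k ≤ K, Sect2Form k`).  Bookkeeping (`uvIneq_of_termData` run by run, step by step). [cite: Balaban1988Convergent, Cor. 3 (2.50) p.264] -/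
theorem cor3With_of_leaves (C : B16.Construction) (R : ReprFamily C) (γ : ℝ) (em ep : ℝ → ℝ)
    (hS : ∀ P : B12.RunParams, (C P).flow.InInterval γ P.K → ∀ k, k ≤ P.K → (C P).Sect2Form k)
    (hH : LeafH C R γ) (hU1 : LeafU1 C R γ) (hU2 : LeafU2 C R γ ep) (hL1 : LeafL1 C R γ)
    (hL2 : LeafL2 C R γ em) :
    B16.Cor3With C γ em ep := by
  intro P hP k hk V
  have hs : (C P).Sect2Form k := hS P hP k hk
  exact uvIneq_of_termData (C P) k (R P k) (em ((C P).flow.g k)) (ep ((C P).flow.g k))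
    (hH P hP k hk hs) (hU1 P hP k hk hs) (hU2 P hP k hk hs) (hL1 P hP k hk hs) (hL2 P hP k hk hs) V

/-- The leaves restrict from ]0, γ] to any smaller interval ]0, γ'] (they are guarded by the interval hypothesis). [folklore] -/
theorem leaves_restrict (C : B16.Construction) (R : ReprFamily C) {γ γ' : ℝ} (hle : γ' ≤ γ) (em ep : ℝ → ℝ)
    (hH : LeafH C R γ) (hU1 : LeafU1 C R γ) (hU2 : LeafU2 C R γ ep) (hL1 : LeafL1 C R γ)
    (hL2 : LeafL2 C R γ em) :
    LeafH C R γ' ∧ LeafU1 C R γ' ∧ LeafU2 C R γ' ep ∧ LeafL1 C R γ' ∧ LeafL2 C R γ' em :=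
  ⟨fun P hP => hH P (inInterval_of_le hP hle), fun P hP => hU1 P (inInterval_of_le hP hle),
    fun P hP => hU2 P (inInterval_of_le hP hle), fun P hP => hL1 P (inInterval_of_le hP hle),
    fun P hP => hL2 P (inInterval_of_le hP hle)⟩

/-- **Corollary 3 from Theorem 1 and the five leaves** (`B16.Cor3_250`): Theorem 1 gives `γ₁` with `Sect2Form k` for
all runs in ]0, γ₁]; the leaves hold on ]0, γ]; on ]0, min γ γ₁] both apply.  Pure quantifier logic. [cite: Balaban1988Convergent, Cor. 3 (2.50) p.264] -/
theorem cor3_250_of_leaves (C : B16.Construction) (R : ReprFamily C) (γ : ℝ) (hγ : 0 < γ) (em ep : ℝ → ℝ)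
    (h1 : B16.Thm1Printed C)
    (hH : LeafH C R γ) (hU1 : LeafU1 C R γ) (hU2 : LeafU2 C R γ ep) (hL1 : LeafL1 C R γ)
    (hL2 : LeafL2 C R γ em) :
    B16.Cor3_250 C := by
  obtain ⟨γ₁, hγ₁, H1⟩ := h1
  obtain ⟨hH', hU1', hU2', hL1', hL2'⟩ :=
    leaves_restrict C R (min_le_left γ γ₁) em ep hH hU1 hU2 hL1 hL2
  refine ⟨min γ γ₁, lt_min hγ hγ₁, em, ep, cor3With_of_leaves C R (min γ γ₁) em ep ?_ hH' hU1' hU2' hL1' hL2'⟩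
  intro P hP k hk
  exact H1 P (inInterval_of_le hP (min_le_right γ γ₁)) k hk

/-- **The sibling module's opaque leaf made explicit**: `B16.Cor3Leaf C` (= `Thm1Printed C → Cor3_250 C`, the printed
claim *"Under the assumptions of Theorem 1 … (2.50)"* / [Balaban1989LargeFieldII] p. 355 *"As an immediate consequence
of this theorem, we get the ultraviolet stability bounds"*) follows from the five located leaves H, U1, U2, L1, L2 on
some interval ]0, γ]. [cite: Balaban1988Convergent, Cor. 3 p.264] -/
theorem cor3Leaf_of_leaves (C : B16.Construction) (R : ReprFamily C) (γ : ℝ) (hγ : 0 < γ) (em ep : ℝ → ℝ)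
    (hH : LeafH C R γ) (hU1 : LeafU1 C R γ) (hU2 : LeafU2 C R γ ep) (hL1 : LeafL1 C R γ)
    (hL2 : LeafL2 C R γ em) :
    B16.Cor3Leaf C :=
  fun h1 => cor3_250_of_leaves C R γ hγ em ep h1 hH hU1 hU2 hL1 hL2

/-- Into (0.1) of [Balaban1989LargeFieldII] (`B16.UVBound01`, constants independent of `k`): Theorem 1 + the five
leaves + dependence functions `e_±` BOUNDED ABOVE on ]0, γ] + the sign convention `χ_k ≥ 0`
(`B16.uvBound01_of_cor3_bounded`).  The boundedness is exactly the printed difference between [III] Cor. 3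
(*"depending on g_k"*) and [V] (0.1) (*"independent of k"*); cell GAPS.md G-r2.7. [cite: Balaban1989LargeFieldII, (0.1) pp.355–356] -/
theorem uvBound01_of_leaves (C : B16.Construction) (R : ReprFamily C) (γ : ℝ) (hγ : 0 < γ) (em ep : ℝ → ℝ)
    (hsign : B16.SignConventions C) (h1 : B16.Thm1Printed C)
    (hH : LeafH C R γ) (hU1 : LeafU1 C R γ) (hU2 : LeafU2 C R γ ep) (hL1 : LeafL1 C R γ)
    (hL2 : LeafL2 C R γ em)
    (hbm : ∃ Em : ℝ, ∀ x, 0 < x → x ≤ γ → em x ≤ Em) (hbp : ∃ Ep : ℝ, ∀ x, 0 < x → x ≤ γ → ep x ≤ Ep) :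
    B16.UVBound01 C := by
  obtain ⟨γ₁, hγ₁, H1⟩ := h1
  obtain ⟨hH', hU1', hU2', hL1', hL2'⟩ :=
    leaves_restrict C R (min_le_left γ γ₁) em ep hH hU1 hU2 hL1 hL2
  have hcor : B16.Cor3With C (min γ γ₁) em ep := by
    refine cor3With_of_leaves C R (min γ γ₁) em ep ?_ hH' hU1' hU2' hL1' hL2'
    intro P hP k hk
    exact H1 P (inInterval_of_le hP (min_le_right γ γ₁)) k hk
  obtain ⟨Em, hEm⟩ := hbm
  obtain ⟨Ep, hEp⟩ := hbp
  exact B16.uvBound01_of_cor3_bounded C hsign ⟨min γ γ₁, lt_min hγ hγ₁, em, ep, hcor,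
    ⟨Em, fun x hx hxle => hEm x hx (hxle.trans (min_le_left γ γ₁))⟩,
    ⟨Ep, fun x hx hxle => hEp x hx (hxle.trans (min_le_left γ γ₁))⟩⟩

/-- Into the pinned end statement (B) of the series (`B16.EndStatementB = Thm1Printed ∧ UVBound01`): Theorem 1 + the
five leaves + bounded dependence functions + `χ_k ≥ 0`. Bookkeeping. [cite: Balaban1989LargeFieldII, Thm 1 + (0.1) pp.355–356] -/
theorem endStatementB_of_leaves (C : B16.Construction) (R : ReprFamily C) (γ : ℝ) (hγ : 0 < γ) (em ep : ℝ → ℝ)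
    (hsign : B16.SignConventions C) (h1 : B16.Thm1Printed C)
    (hH : LeafH C R γ) (hU1 : LeafU1 C R γ) (hU2 : LeafU2 C R γ ep) (hL1 : LeafL1 C R γ)
    (hL2 : LeafL2 C R γ em)
    (hbm : ∃ Em : ℝ, ∀ x, 0 < x → x ≤ γ → em x ≤ Em) (hbp : ∃ Ep : ℝ, ∀ x, 0 < x → x ≤ γ → ep x ≤ Ep) :
    B16.EndStatementB C :=
  ⟨h1, uvBound01_of_leaves C R γ hγ em ep hsign h1 hH hU1 hU2 hL1 hL2 hbm hbp⟩

/-! ## 5. The same bookkeeping for densities on gauge fields (`Step.Repr218`, `Step.DensityRG`) -/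

section StepLevel
variable {P : Params} {G : Type*} [GaugeGroup G]

/-- Gauge-field level, UPPER: if the density `ρ` on `T^{(k)}` has the representation (2.18) (`Step.Repr218.Holds`:
`ρ(V) = Σ_a χ_k(a)(V) · (𝐓_k(a) exp A_k)(V)`), every summand is bounded by a majorant `w(a)` (U1) and `Σ_a w(a) ≤ B`
(U2), then `ρ ≤ B` pointwise — the pointwise form of the upper half of (2.50). [cite: Balaban1988Convergent, Cor. 3 (2.50) p.264] -/
theorem density_le_of_repr218 {k : ℕ} (D : Step.Repr218 P G k) {ρ : Density P k G} (h : D.Holds ρ)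
    (w : D.Adm → ℝ) {B : ℝ} (hterm : ∀ a V, D.χ a V * D.TexpA a V ≤ w a) (hsum : ∑ a, w a ≤ B) :
    ∀ V, ρ V ≤ B :=
  fun V => le_of_sum_repr (fun a => D.χ a V * D.TexpA a V) w (h V) (fun a => hterm a V) hsum

/-- Gauge-field level, LOWER: with (2.18), term-wise non-negativity (L1) and a lower bound `lb` of one chosen summand
`a₀` (L2, the all-small-field sequence), `lb ≤ ρ` pointwise — the lower half of (2.50). [cite: Balaban1988Convergent, Cor. 3 (2.50) p.264] -/
theorem density_ge_of_repr218 {k : ℕ} (D : Step.Repr218 P G k) {ρ : Density P k G} (h : D.Holds ρ)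
    (a₀ : D.Adm) (lb : Density P k G) (hnonneg : ∀ a V, 0 ≤ D.χ a V * D.TexpA a V)
    (hlow : ∀ V, lb V ≤ D.χ a₀ V * D.TexpA a₀ V) :
    ∀ V, lb V ≤ ρ V :=
  fun V => ge_of_sum_repr (fun a => D.χ a V * D.TexpA a V) a₀ (h V) (fun a => hnonneg a V) (hlow V)

variable [MeasurableSpace G] [HaarData G] {av : ∀ j, Averaging P j G}

/-- *"Thus we estimate the integral ∫dV_k ρ_k by a sum of terms …"* (p. 264) at the density level: for the sequence of
densities generated by the operations 𝐑T (`Step.DensityRG`) whose large-field operations preserve integrals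
(`Setup.PreservesIntegral`, [Balaban1989LargeFieldI] (0.4)), the representation (2.18) of `ρ_K` with majorants summing
to `≤ exp c` gives the partition-function bound `Z = ∫dV_K ρ_K ≤ exp c` (`Step.DensityRG.partitionFn_le_exp`).
Bookkeeping. [cite: Balaban1988Convergent, p.264 paragraph before Cor. 3] -/
theorem partitionFn_le_of_repr218 (DRG : Step.DensityRG P G av) (K : ℕ) (c : ℝ)
    (hR : ∀ k, k < K → PreservesIntegral (DRG.R k))
    (D : Step.Repr218 P G K) (h : D.Holds (DRG.ρ K)) (w : D.Adm → ℝ)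
    (hterm : ∀ a V, D.χ a V * D.TexpA a V ≤ w a) (hsum : ∑ a, w a ≤ Real.exp c) :
    DRG.partitionFn ≤ Real.exp c :=
  DRG.partitionFn_le_exp K c hR (density_le_of_repr218 D h w hterm hsum)

end StepLevel

end Literature.MathematicalPhysics.QuantumFieldTheory.Balaban1983to89.B14Cor3
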